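import Literature.Probability.Percolation.SeedCrossingRevealment
import Literature.Probability.Percolation.OneArmOSSSDiffIneqZd
import Literature.Probability.LatticeModels.MeanFieldLowerBound
import HarnessLib

/-!
# QUANT lane (p4 gen 20, census V73): the INTRINSIC O'Donnell–Servedio bound for the derivative of the one-arm
# probability — `θ_n′(r) ≤ √( 2d · θ_n(r)(1 − θ_n(r)) · χ_n^Λ(r) / (r(1−r)) )`, `χ_n^Λ(r) = Σ_{a∈Λ_n} P_r(0 ↔ a in Λ_n)`

builds on p205010 (kernel theorem, internal audit signed; external expert review pending) — NOT used in this file.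

Seat `prim-quant-p4` (METHOD = differential inequalities for `θ` near `p_c`), helper file `--supports
stmt-CriticalPhenomena-4575`; pure proofs, no definitions.  The brief's "Russo + OSSS/Talagrand-type influence bounds":
the tree has the O'Donnell–Servedio revealment inequality for seed-to-target crossings
(`SeedCrossingRevealment.sum_piv_le_sqrt`, gen 14, used there with SPHERE seeds for annulus crossings, Dewan–Muirhead's
Prop. 2.2) and the DRT one-arm cube on `Λ_n` (`OneArmOSSSBox`, gen 13).  Taking the ORIGIN as the only seed, the
exploration of the cluster of `0` inside `Λ_n` computes `𝟙{0 ↔ ∂Λ_n}` and reveals a lattice pair `{a,b} ⊆ Λ_n` with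
probability at most `P(0 ↔ a in Λ_n) + P(0 ↔ b in Λ_n)`; each vertex lies in at most `2d` lattice pairs, so the total
revealment is at most `2d·χ_n^Λ(p)`, the box-truncated susceptibility (the "intrinsic" edge count, vs the `|E(Λ_n)| ≍ n^d`
of the Moore–Shannon / Chayes–Chayes–Fisher–Spencer bound `θ_n′ ≤ √(|E(Λ_n)| θ_n(1−θ_n)/(p(1−p)))` of gen 1):

* §1 `gcross_singleton_eq_garm`, `pivCross_singleton_eq_pivArm` — the seed-`{0}` crossing IS the arm indicator;
  `seedProb_origin_le` — its revealment majorant is the box connectivity `P_p(0 ↔ a in Λ_n)`;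
* §2 **`mul_sum_pivotal_le_sqrt`** — for `d ≥ 1`, every `n`, `p ∈ [0,1]`:
  `p(1−p)·Σ_{e ⊆ Λ_n} P_p(e ∈ E(ℤ^d), e pivotal for {0 ↔ ∂Λ_n}) ≤ √( θ_n(1−θ_n) · p(1−p) · 2d · χ_n^Λ(p) )`;
* §3 **`hasDerivAt_thetaN_le_sqrt_boxSusc`** — with Russo: `θ_n′(r) ≤ √(2d θ_n(r)(1−θ_n(r)) χ_n^Λ(r)/(r(1−r)))` on `(0,1)`;
  the TWO-SIDED one-arm differential inequality at every `r ∈ (0,1)` together with the tree's OSSS lower bound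
  (`OneArmOSSS.oneArm_hasDerivAt_ge`): `n θ_n(1−θ_n)/(4r(1−r)S_n) ≤ θ_n′ ≤ √(2dθ_n(1−θ_n)χ_n^Λ/(r(1−r)))`
  (`oneArm_deriv_two_sided`).

HONEST STATUS / READING.  New as typed (bookkeeping on two kernel tools); mechanism = O'Donnell–Servedio 2007 / Dewan–Muirhead
2022 Prop. 2.10 with the cluster exploration ("intrinsic" Chayes–Chayes).  At `p_c` in mean field (`π_n ≍ n^{−2}`,
`χ_n^Λ ≍ n²`) the bound reads `θ_n′(p_c) = O(1)`, which is the true order (`θ_n(p) ≈ n^{−2}f(n²(p−p_c))`), whereas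
Moore–Shannon gives `n^{(d−2)/2}`; in `d = 3` both sides are unknowns (`π_n`, `χ_n^Λ`), cf. the tree's product bound
`π_N(p_c)χ_N^Λ(p_c) ≥ p_c(1−p_c)/(256d)` (gen 11).  For the INTEGRATED modulus the Hutchcroft/KL route of gen 11
(`CritOneArm.theta_le_two_mul_oneArmProb_add`) already gives `θ(q) ≤ 2π_N(p_c) + K(q−p_c)²χ_N^Λ(p_c)` without a window
condition, so no new (T2) statement is claimed; this file records the DERIVATIVE bound (a tool).  No rate at `p_c`;
(T1)/(T2) unchanged.

## References
* R. O'Donnell, *Analysis of Boolean Functions* (2014), §8.6 (OS inequality) [ODonnell2014].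
* V. Dewan, S. Muirhead, PTRF (2022), Prop. 2.10, Lemma 2.9 [DewanMuirhead2022].
* H. Duminil-Copin, A. Raoufi, V. Tassion, Ann. Math. 189 (2019), §3 (the one-arm cube and Russo) [DuminilCopinRaoufiTassion2019].
* G. Grimmett, *Percolation* (1999), Thm (2.36)(a) (Moore–Shannon) [GrimmettPercolation1999].
-/

noncomputable section

namespace Summit.CriticalPhenomena.PercolationContinuityZ3.Theorems

namespace OneArmOS

open MeasureTheory Finset Function Literature.Probability.Percolation Literature.Probability.LatticeModels
open Literature.Probability.ODonnellSaksSchrammServedio2005 Literature.Probability.Percolation.OneArmOSSS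
open Literature.Probability.Percolation.SeedExploration Literature.Probability.Percolation.GhostExploration
open scoped Classical

variable {d : ℕ}

/-! ### §1. The seed `{0}`: crossing = arm, revealment majorant = box connectivity -/

/-- With the single seed `o`, the seed-to-target crossing indicator is the arm indicator `𝟙{o ↔ B}`. -/
theorem gcross_singleton_eq_garm {W E : Type*} (edge : W → W → Option E) (o : W) (B : Set W) :
    gcross edge {o} B = garm edge o B := by
  funext y
  unfold gcross garm SConn Conn
  simp only [Set.mem_singleton_iff, exists_eq_left]

/-- With the single seed `o`, the crossing pivotality is the arm pivotality. -/
theorem pivCross_singleton_eq_pivArm {W E : Type*} [DecidableEq E] [Fintype E] (edge : W → W → Option E) (p : E → ℝ) (o : W)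
    (B : Set W) (e : E) : pivCross edge p {o} B e = pivArm edge p o B e := by
  unfold pivCross pivArm
  rw [gcross_singleton_eq_garm]

/-- **The revealment majorant for the seed `{0}`**: `P(a ↔ {0}) ≤ P_p(0 ↔ a in Λ_n)` (an open path of the box cube with the
lattice incidence is an open lattice path inside `Λ_n`). -/
theorem seedProb_origin_le (n : ℕ) (p : unitInterval) (a : BoxV d n) :
    seedProb (latEdge d n) (boxBias d n p) {origin d n} a ≤
      (bondPercolation (zdGraph d) p).real (openConnIn (↑(box d n) : Set (Site d)) 0 a.1) := by
  unfold seedProb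
  rw [← real_setOf_toCube n p (fun x => SeedConn (latEdge d n) {origin d n} x a)]
  refine measureReal_mono fun ω hω => ?_
  obtain ⟨u, hu, hr⟩ := hω
  rw [Set.mem_singleton_iff] at hu
  subst hu
  exact DCT16.mem_openConnIn_of_pathIn (pathIn_of_yReach hr)

/-- `0 ≤ seedProb`. -/
private theorem seedProb_nonneg' (n : ℕ) (p : unitInterval) (Z : Set (BoxV d n)) (a : BoxV d n) :
    0 ≤ seedProb (latEdge d n) (boxBias d n p) Z a :=
  Finset.sum_nonneg fun x _ => mul_nonneg (wt_nonneg (boxBias_nonneg n p.2.1) (boxBias_le_one n p.2.2) x)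
    (by split_ifs <;> norm_num)

/-! ### §2. The O'Donnell–Servedio bound for the one arm with the box susceptibility -/

/-- The number of LATTICE pairs of the box containing a given site is at most `2d` (they are incident edges of `ℤ^d`). -/
private theorem card_filter_mem_lattice_le (n : ℕ) (a : Site d) :
    ((Finset.univ : Finset (PairIdx d n)).filter fun e => a ∈ e.1 ∧ e.1 ∈ (zdGraph d).edgeSet).card ≤ 2 * d := by
  calc ((Finset.univ : Finset (PairIdx d n)).filter fun e => a ∈ e.1 ∧ e.1 ∈ (zdGraph d).edgeSet).card
      ≤ ((zdGraph d).incidenceFinset a).card := by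
        refine Finset.card_le_card_of_injOn (fun e => e.1) (fun e he => ?_) (fun e _ e' _ h => Subtype.ext h)
        rw [Finset.coe_filter, Set.mem_setOf_eq] at he
        rw [Finset.mem_coe, SimpleGraph.mem_incidenceFinset]
        exact ⟨he.2.2, he.2.1⟩
    _ ≤ 2 * d := by
        rw [SimpleGraph.card_incidenceFinset_eq_degree]
        exact card_neighborFinset_zdGraph_le a

/-- **THE INTRINSIC REVEALMENT BOUND (sum of pivotal probabilities).**  For `d ≥ 1`, every `n` and `p ∈ [0,1]`:
`p(1−p) · Σ_{e ⊆ Λ_n} P_p(e ∈ E(ℤ^d), e pivotal for {0 ↔ ∂Λ_n}) ≤ √( θ_n(1−θ_n) · (p(1−p) · 2d · Σ_{a∈Λ_n} P_p(0 ↔ a in Λ_n)) )`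
— O'Donnell–Servedio's inequality for the exploration of the cluster of the origin inside `Λ_n` (seed `{0}`, target
`∂ⁱⁿΛ_n`), whose revealment of a lattice pair `{a,b}` is at most `P_p(0↔a in Λ_n) + P_p(0↔b in Λ_n)`. -/
theorem mul_sum_pivotal_le_sqrt (hd : 1 ≤ d) (n : ℕ) (p : unitInterval) :
    (p : ℝ) * (1 - p) * ∑ z ∈ (box d n).sym2, (bondPercolation (zdGraph d) p).real
        {ω | z ∈ (zdGraph d).edgeSet ∧ IsPivotal (siteToBoundary d n) z ω} ≤
      Real.sqrt ((bondPercolation (zdGraph d) p).real (siteToBoundary d n) *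
        (1 - (bondPercolation (zdGraph d) p).real (siteToBoundary d n)) *
          ((p : ℝ) * (1 - p) * (2 * d * ∑ a ∈ box d n,
            (bondPercolation (zdGraph d) p).real (openConnIn (↑(box d n) : Set (Site d)) 0 a)))) := by
  have _ := hd
  set b := boxBias d n p with hb
  have h0 : ∀ e, 0 ≤ b e := boxBias_nonneg n p.2.1
  have h1 : ∀ e, b e ≤ 1 := boxBias_le_one n p.2.2
  -- the revealment majorant `R e = Σ_{a ∈ e} P(a ↔ 0)`
  set R : PairIdx d n → ℝ := fun e => ∑ a ∈ (Finset.univ : Finset (BoxV d n)).filter (fun a => a.1 ∈ e.1),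
    seedProb (latEdge d n) b {origin d n} a with hR
  have hR0 : ∀ e, 0 ≤ R e := fun e => Finset.sum_nonneg fun a _ => seedProb_nonneg' n p _ a
  have hRe : ∀ e ∈ (Finset.univ : Finset (PairIdx d n)), ∀ a c : BoxV d n, latEdge d n a c = some e →
      seedProb (latEdge d n) b {origin d n} a + seedProb (latEdge d n) b {origin d n} c ≤ R e := by
    intro e _ a c hac
    obtain ⟨hadj, he⟩ := latEdge_eq_some_iff.1 hac
    have hne : a ≠ c := fun h => hadj.ne (congrArg Subtype.val h)
    have ha : a ∈ (Finset.univ : Finset (BoxV d n)).filter (fun x => x.1 ∈ e.1) := by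
      rw [Finset.mem_filter, he]; exact ⟨Finset.mem_univ _, Sym2.mem_mk_left _ _⟩
    have hc : c ∈ (Finset.univ : Finset (BoxV d n)).filter (fun x => x.1 ∈ e.1) := by
      rw [Finset.mem_filter, he]; exact ⟨Finset.mem_univ _, Sym2.mem_mk_right _ _⟩
    rw [hR]
    calc seedProb (latEdge d n) b {origin d n} a + seedProb (latEdge d n) b {origin d n} c
        = ∑ x ∈ ({a, c} : Finset (BoxV d n)), seedProb (latEdge d n) b {origin d n} x := by
          rw [Finset.sum_pair hne]
      _ ≤ _ := Finset.sum_le_sum_of_subset_of_nonneg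
          (by
            intro x hx
            rcases Finset.mem_insert.1 hx with rfl | hx
            · exact ha
            · rw [Finset.mem_singleton.1 hx]; exact hc)
          fun x _ _ => seedProb_nonneg' n p _ x
  -- O'Donnell–Servedio for the seed `{0}`
  have os := SeedExploration.sum_piv_le_sqrt (latEdge_ends n) b h0 h1 {origin d n} (bdryTarget d n) Finset.univ hR0 hRe
  -- left side: Russo's terms
  have hlhs : ∑ e ∈ (Finset.univ : Finset (PairIdx d n)), b e * (1 - b e) * pivCross (latEdge d n) b {origin d n}
      (bdryTarget d n) e = (p : ℝ) * (1 - p) * ∑ z ∈ (box d n).sym2, (bondPercolation (zdGraph d) p).real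
        {ω | z ∈ (zdGraph d).edgeSet ∧ IsPivotal (siteToBoundary d n) z ω} := by
    rw [Finset.sum_congr rfl fun e _ => by rw [pivCross_singleton_eq_pivArm, hb, bias_mul_pivArm_eq n p e],
      ← Finset.mul_sum, ← Finset.sum_coe_sort (box d n).sym2]
  -- the mean: `Σ_x w(x) 𝟙{0↔∂Λ_n}(x) = θ_n`
  have hmean : ∑ y, wt b y * gcross (latEdge d n) {origin d n} (bdryTarget d n) y =
      (bondPercolation (zdGraph d) p).real (siteToBoundary d n) := by
    rw [gcross_singleton_eq_garm, hb, sum_wt_garm_eq]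
  -- the revealment sum: `Σ_e R e · b_e(1−b_e) ≤ p(1−p) · 2d · χ_n^Λ`
  have hrev : ∑ e ∈ (Finset.univ : Finset (PairIdx d n)), R e * (b e * (1 - b e)) ≤
      (p : ℝ) * (1 - p) * (2 * d * ∑ a ∈ box d n,
        (bondPercolation (zdGraph d) p).real (openConnIn (↑(box d n) : Set (Site d)) 0 a)) := by
    -- only lattice pairs contribute, each with the factor `p(1−p)`
    have hterm : ∀ e : PairIdx d n, R e * (b e * (1 - b e)) =
        (p : ℝ) * (1 - p) * (if e.1 ∈ (zdGraph d).edgeSet then R e else 0) := by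
      intro e
      rw [hb]; unfold boxBias
      split_ifs <;> ring
    simp only [hterm, ← Finset.mul_sum]
    refine mul_le_mul_of_nonneg_left ?_ (mul_nonneg p.2.1 (sub_nonneg.2 p.2.2))
    -- `Σ_{e lattice} Σ_{a ∈ e} s(a) = Σ_a s(a) · #{lattice e ∋ a} ≤ 2d Σ_a s(a)`
    rw [← Finset.sum_filter]
    have hswap : ∑ e ∈ (Finset.univ : Finset (PairIdx d n)).filter (fun e => e.1 ∈ (zdGraph d).edgeSet), R e =
        ∑ a : BoxV d n, ∑ e ∈ (Finset.univ : Finset (PairIdx d n)).filter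
          (fun e => a.1 ∈ e.1 ∧ e.1 ∈ (zdGraph d).edgeSet), seedProb (latEdge d n) b {origin d n} a := by
      rw [hR]
      rw [Finset.sum_comm' (t' := Finset.univ)
        (s' := fun a => (Finset.univ : Finset (PairIdx d n)).filter (fun e => a.1 ∈ e.1 ∧ e.1 ∈ (zdGraph d).edgeSet))]
      intro e a
      simp only [Finset.mem_filter, Finset.mem_univ, true_and]
      tauto
    rw [hswap]
    calc ∑ a : BoxV d n, ∑ e ∈ (Finset.univ : Finset (PairIdx d n)).filter
          (fun e => a.1 ∈ e.1 ∧ e.1 ∈ (zdGraph d).edgeSet), seedProb (latEdge d n) b {origin d n} a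
        = ∑ a : BoxV d n, (((Finset.univ : Finset (PairIdx d n)).filter
            (fun e => a.1 ∈ e.1 ∧ e.1 ∈ (zdGraph d).edgeSet)).card : ℝ) * seedProb (latEdge d n) b {origin d n} a := by
          simp [Finset.sum_const, nsmul_eq_mul]
      _ ≤ ∑ a : BoxV d n, (2 * d : ℝ) * (bondPercolation (zdGraph d) p).real
            (openConnIn (↑(box d n) : Set (Site d)) 0 a.1) := by
          refine Finset.sum_le_sum fun a _ => mul_le_mul ?_ (seedProb_origin_le n p a) (seedProb_nonneg' n p _ a)
            (by positivity)
          exact_mod_cast card_filter_mem_lattice_le n a.1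
      _ = 2 * d * ∑ a ∈ box d n, (bondPercolation (zdGraph d) p).real (openConnIn (↑(box d n) : Set (Site d)) 0 a) := by
          rw [Finset.mul_sum, ← Finset.sum_coe_sort (box d n)]
  rw [hlhs, hmean] at os
  refine os.trans (Real.sqrt_le_sqrt (mul_le_mul_of_nonneg_left hrev (mul_nonneg measureReal_nonneg ?_)))
  linarith [measureReal_le_one (μ := bondPercolation (zdGraph d) p) (s := siteToBoundary d n)]

/-! ### §3. Derivative forms -/

/-- The real parameter `r ∈ [0,1]` read back from `Set.projIcc 0 1`. -/
private theorem coe_projIcc_of_mem {r : ℝ} (h0 : 0 ≤ r) (h1 : r ≤ 1) :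
    ((Set.projIcc (0 : ℝ) 1 zero_le_one r : unitInterval) : ℝ) = r :=
  congrArg Subtype.val (Set.projIcc_of_mem zero_le_one ⟨h0, h1⟩)

/-- **The intrinsic bound for `θ_n′` (`HasDerivAt` form)**: for `d ≥ 1`, every `n` and `r ∈ (0,1)`, `θ_n` is differentiable at
`r` with derivative `D = Σ_{e⊆Λ_n} P_r(e ∈ E, e pivotal) ≥ 0` and
`D ≤ √( 2d · θ_n(r)(1−θ_n(r)) · χ_n^Λ(r) / (r(1−r)) )`, `χ_n^Λ(r) = Σ_{a∈Λ_n} P_r(0 ↔ a in Λ_n)`. -/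
theorem hasDerivAt_thetaN_le_sqrt_boxSusc (hd : 1 ≤ d) (n : ℕ) {r : ℝ} (hr : r ∈ Set.Ioo (0 : ℝ) 1) :
    ∃ D : ℝ, HasDerivAt (DCT16.thetaN d n) D r ∧ 0 ≤ D ∧
      D ≤ Real.sqrt (2 * d * (DCT16.thetaN d n r * (1 - DCT16.thetaN d n r)) *
        (∑ a ∈ box d n, (bondPercolation (zdGraph d) (Set.projIcc 0 1 zero_le_one r)).real
          (openConnIn (↑(box d n) : Set (Site d)) 0 a)) / (r * (1 - r))) := by
  have hpI : r ∈ Set.Icc (0 : ℝ) 1 := ⟨hr.1.le, hr.2.le⟩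
  set pr : unitInterval := Set.projIcc 0 1 zero_le_one r with hpr
  have hcr : (pr : ℝ) = r := coe_projIcc_of_mem hr.1.le hr.2.le
  set D : ℝ := ∑ z ∈ (box d n).sym2, (bondPercolation (zdGraph d) pr).real
    {ω | z ∈ (zdGraph d).edgeSet ∧ IsPivotal (siteToBoundary d n) z ω} with hD
  have hderiv : HasDerivAt (DCT16.thetaN d n) D r :=
    russo_formula_sum_holds (zdGraph d) (DCT16.isUpperSet_siteToBoundary d n) ((box d n).sym2)
      (DCT16.determinedBy_siteToBoundary d n) r hr
  have hD0 : 0 ≤ D := Finset.sum_nonneg fun _ _ => measureReal_nonneg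
  refine ⟨D, hderiv, hD0, ?_⟩
  have h := mul_sum_pivotal_le_sqrt hd n pr
  rw [hcr] at h
  have hθ : (bondPercolation (zdGraph d) pr).real (siteToBoundary d n) = DCT16.thetaN d n r := rfl
  rw [hθ] at h
  have hrr : 0 < r * (1 - r) := mul_pos hr.1 (by linarith [hr.2])
  set X : ℝ := DCT16.thetaN d n r * (1 - DCT16.thetaN d n r) with hX
  set C : ℝ := 2 * d * ∑ a ∈ box d n, (bondPercolation (zdGraph d) pr).real (openConnIn (↑(box d n) : Set (Site d)) 0 a)
    with hC
  have hθ0 : 0 ≤ DCT16.thetaN d n r := measureReal_nonneg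
  have hθ1 : DCT16.thetaN d n r ≤ 1 := measureReal_le_one
  have hX0 : 0 ≤ X := mul_nonneg hθ0 (by linarith)
  have hC0 : 0 ≤ C := by rw [hC]; exact mul_nonneg (by positivity) (Finset.sum_nonneg fun _ _ => measureReal_nonneg)
  -- `r(1−r) D ≤ √(X · r(1−r) · C)` ⟹ `D ≤ √(X C /(r(1−r)))`
  have h' : r * (1 - r) * D ≤ Real.sqrt (X * (r * (1 - r) * C)) := h
  rw [show 2 * (d : ℝ) * X * (∑ a ∈ box d n, (bondPercolation (zdGraph d) pr).real
      (openConnIn (↑(box d n) : Set (Site d)) 0 a)) / (r * (1 - r)) = X * C / (r * (1 - r)) by rw [hC]; ring]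
  rw [Real.le_sqrt hD0 (div_nonneg (mul_nonneg hX0 hC0) hrr.le), le_div_iff₀ hrr]
  have h2 := Real.le_sqrt (mul_nonneg hrr.le hD0) (mul_nonneg hX0 (mul_nonneg hrr.le hC0)) |>.1 h'
  nlinarith [h2, hrr]

/-- **The intrinsic bound for `θ_n′`**: `θ_n′(r) ≤ √(2d θ_n(r)(1−θ_n(r)) χ_n^Λ(r)/(r(1−r)))` for `d ≥ 1`, every `n`,
`r ∈ (0,1)`. -/
theorem deriv_thetaN_le_sqrt_boxSusc (hd : 1 ≤ d) (n : ℕ) {r : ℝ} (hr : r ∈ Set.Ioo (0 : ℝ) 1) :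
    deriv (DCT16.thetaN d n) r ≤ Real.sqrt (2 * d * (DCT16.thetaN d n r * (1 - DCT16.thetaN d n r)) *
        (∑ a ∈ box d n, (bondPercolation (zdGraph d) (Set.projIcc 0 1 zero_le_one r)).real
          (openConnIn (↑(box d n) : Set (Site d)) 0 a)) / (r * (1 - r))) := by
  obtain ⟨D, hD, -, hle⟩ := hasDerivAt_thetaN_le_sqrt_boxSusc (d := d) hd n hr
  rw [hD.deriv]; exact hle

/-- **The two-sided one-arm differential inequality at every `r ∈ (0,1)`**: with `S_n(r) = Σ_{k<n} θ_k(r)`,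
`n·θ_n(1−θ_n) ≤ 4r(1−r)·S_n·θ_n′` (OSSS, Duminil-Copin–Raoufi–Tassion; tree) and
`θ_n′ ≤ √(2d θ_n(1−θ_n) χ_n^Λ/(r(1−r)))` (O'Donnell–Servedio, this file). -/
theorem oneArm_deriv_two_sided (hd : 1 ≤ d) (n : ℕ) {r : ℝ} (hr : r ∈ Set.Ioo (0 : ℝ) 1) :
    (n : ℝ) * (DCT16.thetaN d n r * (1 - DCT16.thetaN d n r)) ≤
        4 * (r * (1 - r)) * (∑ k ∈ Finset.range n, DCT16.thetaN d k r) * deriv (DCT16.thetaN d n) r ∧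
      deriv (DCT16.thetaN d n) r ≤ Real.sqrt (2 * d * (DCT16.thetaN d n r * (1 - DCT16.thetaN d n r)) *
        (∑ a ∈ box d n, (bondPercolation (zdGraph d) (Set.projIcc 0 1 zero_le_one r)).real
          (openConnIn (↑(box d n) : Set (Site d)) 0 a)) / (r * (1 - r))) :=
  ⟨oneArm_deriv_ge hd n hr, deriv_thetaN_le_sqrt_boxSusc hd n hr⟩

end OneArmOS

end Summit.CriticalPhenomena.PercolationContinuityZ3.Theorems

end
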